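import Summits.ResolutionOfSingularities.ResolutionOfSingularities.Theorems.PurelyInseparableDim4ChartAtlasSNCFarRepairReading
import HarnessLib

/-!
# Purely inseparable four-folds `z^p + F(x₁, …, x₄)`: THE OTHER RESONANCE LOCI read on the chart of the one-height repair — they are
# resonance loci of the repaired centre at the SHIFTED heights (chart model; cell `res-dim4-pi`, typ-2 g8; HANDOFF g7 OPEN 4, the
# many-heights step of `…SNCFarRepairReadingHeights`)

[OURS · counted 0] (D-0157 DOOR 2; DR-157-C.) The many-heights repair of p718376 / p720339 blows up `C(hs) = Π_{h ∈ hs} C_h`,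
`C_h = ψ_{−h}^*𝓘(V(y_0, y_T, y_j))`, in ONE step; Literature `IsBlowup.exists_comp_eq_of_mul` factors such a blowing up as `τ₂ ≫ τ₁` with
`τ₁` a blowing up along `C_h` and `τ₂` one along `τ₁^*C(hs′)`. To iterate the one-height reading (p723027 `farRepair_chart_reading`) one
must know `τ₁^*C(hs′)` on the chart `φ₁ = Spec Θ ≫ (y_j-chart of τ₁ ≫ ψ_{−h})` of the repaired centre. PROVED here (no `sorry`, no new axiom):

* `comap_specMap_ofIdealTop_span_image` — book-keeping: `(Spec Φ)^*` of the ideal sheaf of `(S)` is the ideal sheaf of `(Φ(S))`, and only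
  the SPAN of the generators matters;
* `translateEquiv_single_comp_add`, `spec_translate_single_comp_add` — `ψ_s ≫ ψ_t = ψ_{s+t}` for the `y_j`-translations;
* `span_subst_heightGens_eq`, `span_clean_heightGens_eq` — the generators `y_0, y_T, y_j + c` (`c ≠ 0`) of a resonance locus OFF the
  height span the same ideal as their images under the chart substitution `ψ_{j}` (`y_i ↦ y_j·yᵢ` on the centre variables: `y_j` is a unit
  modulo `y_j + c`) and under a cleaning `Θ` (`z ↦ z + g`, `g ∈ (y_T)`);
* **`comap_chart_heightLocus`** — for ANY blowing up `τ` of `𝔸⁵` along `C_h` and `h′ ≠ h`: `φ₁^* τ^* C_{h′} = C_{h′ − h}` — on the chart of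
  the repaired centre the locus `Zc ∩ {y_j = h′}` reads `V(y_0, y_T) ∩ {y_j = h′ − h}`;
* `comap_list_prod`, **`comap_chart_heightLoci`** — hence `φ₁^* τ^* C(hs′) = C(hs′.map (· − h))` for `h ∉ hs′`: the remaining repair is the
  SAME many-heights repair of the repaired centre, at the shifted heights (the induction step of `…ReadingHeights`).

Nothing here is a statement about resolution of singularities in dimension ≥ 4 / characteristic `p` (NOT proved anywhere in this programme).
bears_on: LADDER-RESOLUTION:D157-DOOR2 (res-dim4-pi). Supports stmt-ResolutionOfSingularities-16155 (helper).
-/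

-- every declaration of this summit lives under `Summit.ResolutionOfSingularities.ResolutionOfSingularities`
-- (summit = problem), which the duplicate-namespace linter flags; house convention (cf. the Target file).
set_option linter.dupNamespace false

noncomputable section

open MvPolynomial CategoryTheory AlgebraicGeometry TopologicalSpace
open AlgebraicGeometry.Scheme.IdealSheafData (ofIdealTop)

namespace Summit.ResolutionOfSingularities.ResolutionOfSingularities.Theorems.PIDim4

open Literature.AlgebraicGeometry.Resolution
open Literature.AlgebraicGeometry.Resolution.AffinePointBlowup (P A γ coord)

namespace ChartDictionary

/-! ## §1 Book-keeping -/

section Book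

variable {K : Type} [Field K] {j : Fin 4}

/-- **`(Spec Φ)^*` of the ideal sheaf of `(S)` is the ideal sheaf of `(Φ(S))`; only the span of the generators matters.** -/
theorem comap_specMap_ofIdealTop_span_image (Φ : A 4 K →+* A 4 K) {S S' : Set (A 4 K)} (hS : Ideal.span (Φ '' S) = Ideal.span S') :
    (ofIdealTop (Ideal.span ((γ 4 K).symm '' S))).comap (Spec.map (CommRingCat.ofHom Φ)) = ofIdealTop (Ideal.span ((γ 4 K).symm '' S')) := by
  rw [comap_ofIdealTop_of_isAffine, Ideal.map_span, ← Set.image_comp]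
  have himg : ((Spec.map (CommRingCat.ofHom Φ)).appTop.hom ∘ (γ 4 K).symm) '' S = (γ 4 K).symm '' (Φ '' S) := by
    rw [← Set.image_comp]
    refine Set.image_congr fun a _ => ?_
    rw [Function.comp_apply, Function.comp_apply, appTop_specMap_γ_symm]
  rw [himg, ← Ideal.map_span (γ 4 K).symm, ← Ideal.map_span (γ 4 K).symm, hS]

/-- The ideal sheaf of `V(y_Λ)` as the ideal sheaf of a span of an image under `γ⁻¹`. -/
theorem 𝓘Λ_eq_ofIdealTop_image (Λ : Set (Fin (4 + 1))) :
    AffineCoordBlowup.𝓘Λ 4 K Λ = ofIdealTop (Ideal.span ((γ 4 K).symm '' (X '' Λ))) := by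
  rw [𝓘Λ_eq_ofIdealTop, ← Set.image_comp]
  rfl

/-- `θ_s ∘ θ_t = θ_{t + s}` for the `y_j`-translations `θ_t : y_j ↦ y_j + t` (as ring maps). -/
theorem translateEquiv_single_comp_add (s t : K) :
    ((AffinePointBlowup.translateEquiv (n := 4) (Pi.single j.succ s) : A 4 K ≃ₐ[K] A 4 K) : A 4 K →+* A 4 K).comp
        ((AffinePointBlowup.translateEquiv (n := 4) (Pi.single j.succ t) : A 4 K ≃ₐ[K] A 4 K) : A 4 K →+* A 4 K) =
      ((AffinePointBlowup.translateEquiv (n := 4) (Pi.single j.succ (s + t)) : A 4 K ≃ₐ[K] A 4 K) : A 4 K →+* A 4 K) := by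
  refine MvPolynomial.ringHom_ext (fun a => ?_) (fun m => ?_)
  · rw [RingHom.comp_apply, RingHom.coe_coe, RingHom.coe_coe, RingHom.coe_coe, translateEquiv_single_C, translateEquiv_single_C,
      translateEquiv_single_C]
  · rw [RingHom.comp_apply, RingHom.coe_coe, RingHom.coe_coe, RingHom.coe_coe, AffinePointBlowup.translateEquiv_X, map_add,
      AffinePointBlowup.translateEquiv_X, translateEquiv_single_C, AffinePointBlowup.translateEquiv_X, add_assoc, ← C_add]
    by_cases hm : m = j.succ
    · subst hm
      rw [Pi.single_eq_same, Pi.single_eq_same, Pi.single_eq_same]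
    · rw [Pi.single_eq_of_ne hm, Pi.single_eq_of_ne hm, Pi.single_eq_of_ne hm, add_zero]

/-- **`ψ_s ≫ ψ_t = ψ_{s + t}`** for the `y_j`-translations of `𝔸⁵`. -/
theorem spec_translate_single_comp_add (s t : K) :
    Spec.map (CommRingCat.ofHom ((AffinePointBlowup.translateEquiv (n := 4) (Pi.single j.succ s) : A 4 K ≃ₐ[K] A 4 K) : A 4 K →+* A 4 K)) ≫
      Spec.map (CommRingCat.ofHom ((AffinePointBlowup.translateEquiv (n := 4) (Pi.single j.succ t) : A 4 K ≃ₐ[K] A 4 K) :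
        A 4 K →+* A 4 K)) =
      Spec.map (CommRingCat.ofHom ((AffinePointBlowup.translateEquiv (n := 4) (Pi.single j.succ (s + t)) : A 4 K ≃ₐ[K] A 4 K) :
        A 4 K →+* A 4 K)) := by
  rw [← Spec.map_comp, ← CommRingCat.ofHom_comp, translateEquiv_single_comp_add]

/-- Pull-back of a list product of ideal sheaves is the list product of the pull-backs. -/
theorem comap_list_prod {X Y : Scheme.{0}} (f : X ⟶ Y) (L : List Y.IdealSheafData) :
    (L.prod).comap f = (L.map (·.comap f)).prod := by
  induction L with
  | nil => simp only [List.prod_nil, List.map_nil, Scheme.IdealSheafData.one_eq_top, Scheme.IdealSheafData.comap_top]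
  | cons K L ih => rw [List.prod_cons, List.map_cons, List.prod_cons, comap_mul, ih]

end Book

/-! ## §2 The resonance locus at height `−c` by generators; its generators under the chart substitution and under a cleaning -/

section Span

variable {K : Type} [Field K] {T : Finset (Fin 4)} {j : Fin 4}

/-- The centre variables of `V(y_0, y_{T ∪ {j}})` are `y_j` and those of `V(y_0, y_T)`. -/
theorem centreVars_insert_eq (T : Finset (Fin 4)) (j : Fin 4) :
    (insert 0 (Fin.succ '' ((insert j T : Finset (Fin 4)) : Set (Fin 4))) : Set (Fin (4 + 1))) =
      insert j.succ (insert 0 (Fin.succ '' (T : Set (Fin 4)))) := by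
  rw [Finset.coe_insert, Set.image_insert_eq, Set.insert_comm]

/-- **The resonance locus at height `−c` by generators**: `ψ_c^* 𝓘(V(y_0, y_{T ∪ {j}}))` is the ideal sheaf of `(y_j + c, y_0, y_T)`. -/
theorem comap_spec_translate_𝓘Λ_insert_eq (hjT : j ∉ T) (c : K) :
    (AffineCoordBlowup.𝓘Λ 4 K (insert 0 (Fin.succ '' ((insert j T : Finset (Fin 4)) : Set (Fin 4))))).comap
        (Spec.map (CommRingCat.ofHom ((AffinePointBlowup.translateEquiv (n := 4) (Pi.single j.succ c) : A 4 K ≃ₐ[K] A 4 K) :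
          A 4 K →+* A 4 K))) =
      ofIdealTop (Ideal.span ((γ 4 K).symm '' insert (X j.succ + C c) (X '' (insert 0 (Fin.succ '' (T : Set (Fin 4))))))) := by
  rw [𝓘Λ_eq_ofIdealTop_image]
  refine comap_specMap_ofIdealTop_span_image _ (congrArg Ideal.span ?_)
  rw [centreVars_insert_eq, Set.image_insert_eq, Set.image_insert_eq, RingHom.coe_coe, AffinePointBlowup.translateEquiv_X, Pi.single_eq_same,
    ← Set.image_comp]
  congr 1
  refine Set.image_congr fun i hi => ?_
  have hij : i ≠ j.succ := by
    rintro rfl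
    exact hjT ((succ_mem_centreVars_iff T j).mp hi)
  simp only [Function.comp_apply, AffinePointBlowup.translateEquiv_X, Pi.single_eq_of_ne hij, C_0, add_zero]

/-- **The chart substitution `ψ_j` of the blow-up of `V(y_0, y_{T ∪ {j}})` does not change the ideal `(y_j + c, y_0, y_T)` for `c ≠ 0`**
(`y_0 ↦ y_j·y_0`, `y_t ↦ y_j·y_t`, and `y_j` is a unit modulo `y_j + c`). -/
theorem span_subst_heightGens_eq (hjT : j ∉ T) {c : K} (hc : c ≠ 0) :
    Ideal.span ((fun q : A 4 K => coordBlowupSubst K (insert 0 (Fin.succ '' ((insert j T : Finset (Fin 4)) : Set (Fin 4)))) j.succ q) ''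
        insert (X j.succ + C c) (X '' (insert 0 (Fin.succ '' (T : Set (Fin 4)))))) =
      Ideal.span (insert (X j.succ + C c) (X '' (insert 0 (Fin.succ '' (T : Set (Fin 4)))))) := by
  classical
  have hsub : ∀ i ∈ (insert 0 (Fin.succ '' (T : Set (Fin 4))) : Set (Fin (4 + 1))),
      coordBlowupSubst K (insert 0 (Fin.succ '' ((insert j T : Finset (Fin 4)) : Set (Fin 4)))) j.succ (X i : A 4 K) = X j.succ * X i := by
    intro i hi
    have hij : i ≠ j.succ := by
      rintro rfl
      exact hjT ((succ_mem_centreVars_iff T j).mp hi)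
    exact coordBlowupSubst_X_of_mem_of_ne K _ j.succ (centreVars_subset_centreVars_insert T j hi) hij
  have hj : coordBlowupSubst K (insert 0 (Fin.succ '' ((insert j T : Finset (Fin 4)) : Set (Fin 4)))) j.succ (X j.succ + C c : A 4 K) =
      X j.succ + C c := by
    rw [map_add, coordBlowupSubst_X_self, coordBlowupSubst_C]
  refine le_antisymm (Ideal.span_le.mpr ?_) (Ideal.span_le.mpr ?_)
  · rintro _ ⟨q, hq, rfl⟩
    dsimp only
    rcases Set.mem_insert_iff.mp hq with rfl | ⟨i, hi, rfl⟩
    · rw [SetLike.mem_coe, hj]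
      exact Ideal.subset_span (Set.mem_insert _ _)
    · rw [SetLike.mem_coe, hsub i hi]
      exact Ideal.mul_mem_left _ _ (Ideal.subset_span (Set.mem_insert_of_mem _ ⟨i, hi, rfl⟩))
  · intro q hq
    have hjc : (X j.succ + C c : A 4 K) ∈ Ideal.span ((fun q : A 4 K => coordBlowupSubst K
        (insert 0 (Fin.succ '' ((insert j T : Finset (Fin 4)) : Set (Fin 4)))) j.succ q) ''
        insert (X j.succ + C c) (X '' (insert 0 (Fin.succ '' (T : Set (Fin 4)))))) :=
      Ideal.subset_span ⟨X j.succ + C c, Set.mem_insert _ _, hj⟩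
    rcases Set.mem_insert_iff.mp hq with rfl | ⟨i, hi, rfl⟩
    · exact hjc
    · have hXi : (X j.succ * X i : A 4 K) ∈ Ideal.span ((fun q : A 4 K => coordBlowupSubst K
          (insert 0 (Fin.succ '' ((insert j T : Finset (Fin 4)) : Set (Fin 4)))) j.succ q) ''
          insert (X j.succ + C c) (X '' (insert 0 (Fin.succ '' (T : Set (Fin 4)))))) :=
        Ideal.subset_span ⟨X i, Set.mem_insert_of_mem _ ⟨i, hi, rfl⟩, hsub i hi⟩
      have e1 : (X i : A 4 K) = C c⁻¹ * ((X j.succ + C c) * X i - X j.succ * X i) := by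
        rw [show ((X j.succ + C c) * X i - X j.succ * X i : A 4 K) = C c * X i by ring, ← mul_assoc, ← C_mul, inv_mul_cancel₀ hc, C_1,
          one_mul]
      rw [SetLike.mem_coe, e1]
      exact Ideal.mul_mem_left _ _ (Ideal.sub_mem _ (Ideal.mul_mem_right _ _ hjc) hXi)

/-- **A cleaning automorphism `Θ` (`z ↦ z + g`, `yᵢ ↦ yᵢ`, `g ∈ (y_T)`) does not change the ideal `(y_j + c, y_0, y_T)`.** -/
theorem span_clean_heightGens_eq {Θ : A 4 K ≃ₐ[K] A 4 K} {g : MvPolynomial (Fin 4) K} (h0 : Θ (X 0) = X 0 + rename Fin.succ g)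
    (hs : ∀ i : Fin 4, Θ (X i.succ) = X i.succ) (hg : g ∈ Ideal.span (X '' (T : Set (Fin 4)) : Set (MvPolynomial (Fin 4) K))) (c : K) :
    Ideal.span ((fun q : A 4 K => Θ q) '' insert (X j.succ + C c) (X '' (insert 0 (Fin.succ '' (T : Set (Fin 4)))))) =
      Ideal.span (insert (X j.succ + C c) (X '' (insert 0 (Fin.succ '' (T : Set (Fin 4)))))) := by
  have hC : Θ (C c) = C c := Θ.commutes c
  rw [Set.image_insert_eq, map_add, hs j, hC, ← Set.image_comp, Ideal.span_insert, Ideal.span_insert]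
  congr 1
  exact span_clean_image_eq h0 hs hg

end Span

/-! ## §3 The other resonance loci on the chart of the one-height repair -/

section Locus

variable {K : Type} [Field K] {T : Finset (Fin 4)} {j : Fin 4} {Θ : A 4 K ≃ₐ[K] A 4 K} {g : MvPolynomial (Fin 4) K} {h : K}
  {V' : Scheme.{0}} {τ : V' ⟶ P 4 K}

/-- **THE RESONANCE LOCUS AT ANOTHER HEIGHT `h′ ≠ h`, read on the chart of the repaired centre**: for ANY blowing up `τ` of `𝔸⁵` along `C_h`
and a cleaning `Θ` with `g ∈ (y_T)`, `(Spec Θ ≫ chart_j(τ ≫ ψ_{−h}))^* τ^* C_{h′} = C_{h′ − h}`. -/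
theorem comap_chart_heightLocus (hjT : j ∉ T) (h0 : Θ (X 0) = X 0 + rename Fin.succ g) (hs : ∀ i : Fin 4, Θ (X i.succ) = X i.succ)
    (hg : g ∈ Ideal.span (X '' (T : Set (Fin 4)) : Set (MvPolynomial (Fin 4) K))) {h' : K} (hne : h' ≠ h)
    (hτ : IsBlowup τ ((AffineCoordBlowup.𝓘Λ 4 K (insert 0 (Fin.succ '' ((insert j T : Finset (Fin 4)) : Set (Fin 4))))).comap
      (Spec.map (CommRingCat.ofHom ((AffinePointBlowup.translateEquiv (n := 4) (Pi.single j.succ (-h)) : A 4 K ≃ₐ[K] A 4 K) :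
        A 4 K →+* A 4 K))))) :
    (((AffineCoordBlowup.𝓘Λ 4 K (insert 0 (Fin.succ '' ((insert j T : Finset (Fin 4)) : Set (Fin 4))))).comap
        (Spec.map (CommRingCat.ofHom ((AffinePointBlowup.translateEquiv (n := 4) (Pi.single j.succ (-h')) : A 4 K ≃ₐ[K] A 4 K) :
          A 4 K →+* A 4 K)))).comap τ).comap
        (Spec.map (CommRingCat.ofHom (Θ : A 4 K →+* A 4 K)) ≫
          AffineCoordBlowup.chartImm (isBlowup_comp_spec_translate hτ) (succ_mem_centreVars (Finset.mem_insert_self j T))) =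
      (AffineCoordBlowup.𝓘Λ 4 K (insert 0 (Fin.succ '' ((insert j T : Finset (Fin 4)) : Set (Fin 4))))).comap
        (Spec.map (CommRingCat.ofHom ((AffinePointBlowup.translateEquiv (n := 4) (Pi.single j.succ (-(h' - h))) : A 4 K ≃ₐ[K] A 4 K) :
          A 4 K →+* A 4 K))) := by
  set Λ : Set (Fin (4 + 1)) := insert 0 (Fin.succ '' ((insert j T : Finset (Fin 4)) : Set (Fin 4))) with hΛ
  set ψm := Spec.map (CommRingCat.ofHom ((AffinePointBlowup.translateEquiv (n := 4) (Pi.single j.succ (-h)) : A 4 K ≃ₐ[K] A 4 K) :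
    A 4 K →+* A 4 K)) with hψm
  set ψp := Spec.map (CommRingCat.ofHom ((AffinePointBlowup.translateEquiv (n := 4) (Pi.single j.succ h) : A 4 K ≃ₐ[K] A 4 K) :
    A 4 K →+* A 4 K)) with hψp
  have hτ' : IsBlowup (τ ≫ ψm) (AffineCoordBlowup.𝓘Λ 4 K Λ) := isBlowup_comp_spec_translate hτ
  have hmp : ψm ≫ ψp = 𝟙 _ := by
    have h1 := spec_translate_single_comp (K := K) (j := j) (-h)
    rwa [neg_neg] at h1
  -- the chart followed by `τ` is the chart substitution followed by `ψ_h`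
  have hchart : AffineCoordBlowup.chartImm hτ' (succ_mem_centreVars (Finset.mem_insert_self j T)) ≫ τ =
      Spec.map (CommRingCat.ofHom (coordBlowupSubst K Λ j.succ).toRingHom) ≫ ψp := by
    rw [← AffineCoordBlowup.chartImm_comp hτ' (succ_mem_centreVars (Finset.mem_insert_self j T)), Category.assoc, Category.assoc, hmp,
      Category.comp_id]
  have hc : h + -h' ≠ 0 := by
    rw [← sub_eq_add_neg, sub_ne_zero]
    exact hne.symm
  have hcomp : (Spec.map (CommRingCat.ofHom (Θ : A 4 K →+* A 4 K)) ≫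
      AffineCoordBlowup.chartImm hτ' (succ_mem_centreVars (Finset.mem_insert_self j T))) ≫ τ =
      Spec.map (CommRingCat.ofHom (Θ : A 4 K →+* A 4 K)) ≫ Spec.map (CommRingCat.ofHom (coordBlowupSubst K Λ j.succ).toRingHom) ≫ ψp := by
    rw [Category.assoc, hchart]
  -- Step A: translate
  have hA : ((AffineCoordBlowup.𝓘Λ 4 K Λ).comap (Spec.map (CommRingCat.ofHom ((AffinePointBlowup.translateEquiv (n := 4)
      (Pi.single j.succ (-h')) : A 4 K ≃ₐ[K] A 4 K) : A 4 K →+* A 4 K)))).comap ψp =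
      (AffineCoordBlowup.𝓘Λ 4 K Λ).comap (Spec.map (CommRingCat.ofHom ((AffinePointBlowup.translateEquiv (n := 4)
        (Pi.single j.succ (h + -h')) : A 4 K ≃ₐ[K] A 4 K) : A 4 K →+* A 4 K))) := by
    rw [← Scheme.IdealSheafData.comap_comp, hψp, spec_translate_single_comp_add]
  -- Step B: the chart substitution
  have hB : ((AffineCoordBlowup.𝓘Λ 4 K Λ).comap (Spec.map (CommRingCat.ofHom ((AffinePointBlowup.translateEquiv (n := 4)
      (Pi.single j.succ (h + -h')) : A 4 K ≃ₐ[K] A 4 K) : A 4 K →+* A 4 K)))).comap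
      (Spec.map (CommRingCat.ofHom (coordBlowupSubst K Λ j.succ).toRingHom)) =
      (AffineCoordBlowup.𝓘Λ 4 K Λ).comap (Spec.map (CommRingCat.ofHom ((AffinePointBlowup.translateEquiv (n := 4)
        (Pi.single j.succ (h + -h')) : A 4 K ≃ₐ[K] A 4 K) : A 4 K →+* A 4 K))) := by
    rw [hΛ, comap_spec_translate_𝓘Λ_insert_eq hjT]
    exact comap_specMap_ofIdealTop_span_image _ (span_subst_heightGens_eq hjT hc)
  -- Step C: the cleaning
  have hC : ((AffineCoordBlowup.𝓘Λ 4 K Λ).comap (Spec.map (CommRingCat.ofHom ((AffinePointBlowup.translateEquiv (n := 4)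
      (Pi.single j.succ (h + -h')) : A 4 K ≃ₐ[K] A 4 K) : A 4 K →+* A 4 K)))).comap (Spec.map (CommRingCat.ofHom (Θ : A 4 K →+* A 4 K))) =
      (AffineCoordBlowup.𝓘Λ 4 K Λ).comap (Spec.map (CommRingCat.ofHom ((AffinePointBlowup.translateEquiv (n := 4)
        (Pi.single j.succ (h + -h')) : A 4 K ≃ₐ[K] A 4 K) : A 4 K →+* A 4 K))) := by
    rw [hΛ, comap_spec_translate_𝓘Λ_insert_eq hjT]
    exact comap_specMap_ofIdealTop_span_image _ (span_clean_heightGens_eq h0 hs hg (h + -h'))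
  rw [show -(h' - h) = h + -h' by ring, ← Scheme.IdealSheafData.comap_comp, hcomp, Scheme.IdealSheafData.comap_comp,
    Scheme.IdealSheafData.comap_comp, hA, hB, hC]

/-- **… hence ALL the other resonance loci at once**: `(Spec Θ ≫ chart)^* τ^* C(hs′) = C(hs′.map (· − h))` for `h ∉ hs′`. -/
theorem comap_chart_heightLoci (hjT : j ∉ T) (h0 : Θ (X 0) = X 0 + rename Fin.succ g) (hs : ∀ i : Fin 4, Θ (X i.succ) = X i.succ)
    (hg : g ∈ Ideal.span (X '' (T : Set (Fin 4)) : Set (MvPolynomial (Fin 4) K))) {hs' : List K} (hnh : h ∉ hs')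
    (hτ : IsBlowup τ ((AffineCoordBlowup.𝓘Λ 4 K (insert 0 (Fin.succ '' ((insert j T : Finset (Fin 4)) : Set (Fin 4))))).comap
      (Spec.map (CommRingCat.ofHom ((AffinePointBlowup.translateEquiv (n := 4) (Pi.single j.succ (-h)) : A 4 K ≃ₐ[K] A 4 K) :
        A 4 K →+* A 4 K))))) :
    ((hs'.map fun h' => (AffineCoordBlowup.𝓘Λ 4 K (insert 0 (Fin.succ '' ((insert j T : Finset (Fin 4)) : Set (Fin 4))))).comap
        (Spec.map (CommRingCat.ofHom ((AffinePointBlowup.translateEquiv (n := 4) (Pi.single j.succ (-h')) : A 4 K ≃ₐ[K] A 4 K) :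
          A 4 K →+* A 4 K)))).prod.comap τ).comap
        (Spec.map (CommRingCat.ofHom (Θ : A 4 K →+* A 4 K)) ≫
          AffineCoordBlowup.chartImm (isBlowup_comp_spec_translate hτ) (succ_mem_centreVars (Finset.mem_insert_self j T))) =
      ((hs'.map fun h' => h' - h).map fun h'' => (AffineCoordBlowup.𝓘Λ 4 K (insert 0 (Fin.succ '' ((insert j T : Finset (Fin 4)) : Set (Fin 4))))).comap
        (Spec.map (CommRingCat.ofHom ((AffinePointBlowup.translateEquiv (n := 4) (Pi.single j.succ (-h'')) : A 4 K ≃ₐ[K] A 4 K) :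
          A 4 K →+* A 4 K)))).prod := by
  rw [comap_list_prod, comap_list_prod, List.map_map, List.map_map, List.map_map]
  congr 1
  refine List.map_congr_left fun h' hh' => ?_
  simp only [Function.comp_apply]
  exact comap_chart_heightLocus hjT h0 hs hg (fun e : h' = h => hnh (e ▸ hh')) hτ

end Locus

end ChartDictionary

end Summit.ResolutionOfSingularities.ResolutionOfSingularities.Theorems.PIDim4

end
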